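import Summits.Ventures.YMGap.RobustBall.TorusRowsSU2StarW3
import Summits.Ventures.YMGap.RobustBall.RowsSU2
import HarnessLib

/-!
# Venture YMGap, track ROBUST-BALL (Y2) — tier-2 TORUS FRONTIER cells of `SU(2)` up to the star door's endpoints, AT EVERY WEIGHT `κ > 0`
# (`d = 4`: 17/50, 7/20, 9/25; `d = 3` with Y4's currency: 13/25, 27/50, 11/20, 14/25)

HONEST FRAMING. WHAT THIS IS: a venture file (cell `pub-ymgap`, track Y2 ROBUST-BALL, seat ds-2 (g14); 0 compute). The tree's tier-2 TORUS rows of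
`SU(2)` (weighted robust vertex-star door, `TorusRowsSU2StarW.lean` / `TorusRowsSU2StarW3.lean`; every weight `TorusPosWeightSU2W.lean`) stop at
`β_W = 1/3` (`d = 4`) and `β_W = 1/2` (`d = 3`), while the `ℤ^d` DLR cells (`TierTwoFrontierSU2.lean`) reach the door's endpoints `9/25` / `14/25`.
This file closes the gap on the TORUS side with NEW exact-rational certificates (`norm_num`) of the landed schemas `su2_torusClusteringOnBallW_star`
(`d = 4`: `doorPoly 4 c = 12c² + 10c < 1`) and `su2_clusterDomainClusteringW_dim3_star` (`d = 3`: `8c² + 6c < 1`) at the SMALL rate `min κ (1/10000)`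
(majorants `e^{t} ≤ T₄(1/10000)`, `e^{2t} ≤ T₄(1/5000)`, `e^{2ε} ≤ T₄(2ε)` by `exp_le_taylor4`; the frontier has no slack for the rate `1/100` factor
`e^{1/100}`): `d = 4` cells `su2_torusClusteringOnBallW_star_<seventeenFiftieths|sevenTwentieths|nineTwentyFifths>_posWeight : ∀ κ > 0, ∀ β ∈ [0, β_W/2],
TorusClusteringOnBallW 2 4 β κ (2ε) ε (16 e^{2 min κ (1/10000)}) (min κ (1/10000))` at (17/50, .009) (7/20, .0045) (9/25, .0003); `d = 3` cells WITH Y4's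
receiving currency `su2_clusterDomainClusteringW_dim3_star_<thirteenTwentyFifths|twentySevenFiftieths|elevenTwentieths|fourteenTwentyFifths>_posWeight`
(`YM3IR.ClusterDomainClustering ⟨ρ₂, β_W/2, ClusterDomain κ (2ε) ε⟩ suFrobDist (min κ (1/10000))` ∧ torus form) at (13/25, .011) (27/50, .0055)
(11/20, .003) (14/25, .0003) — the `d = 3` Y4 CEILING on the weighted torus ball moves from Wilson `β_W = 1/2` to `14/25` (tree coupling `7/25`), every
`κ > 0`. These ARE strong-coupling LATTICE statements on finite tori `(ℤ/L)^d`, `L ≥ 3`, uniform in `L`; the radii shrink to zero at the endpoints,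
which are where the star DOOR ends (`doorPoly_four_ge_one` / `doorPoly_three_ge_one`, `TierTwoPosWeightMassive.lean`), not phase boundaries.
WHAT THIS IS NOT: `κ = 0` is not reached; nothing about infinite volume here (that is `TierTwoFrontierSU2.lean`), the continuum or the Millennium problem.
-/

noncomputable section

open Finset
open Literature.MathematicalPhysics.QuantumLattice (fundamentalRep)
open Literature.MathematicalPhysics.QuantumFieldTheory hiding ZdEdge
open Literature.MathematicalPhysics.QuantumFieldTheory.Balaban1983to89.StrongCouplingTorusWindow
open Summit.Ventures.YMGap.StarResolventDim (Delta gaugeR doorPoly)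

namespace Summit.Ventures.YMGap.RobustBall

/-! ### `d = 4` frontier cells at every weight `κ > 0` (rate `min κ (1/10000)`) -/

/-- **TIER-2 TORUS FRONTIER CELL `(β_W, ε) = (17 / 50, 0.009)`, `SU(2)`, `d = 4`, AT EVERY WEIGHT `κ > 0`**: every member of the weighted ball
`ClusterDomain κ (9 / 500) (9 / 1000)` clusters exponentially on every torus `(ℤ/L)⁴`, `L ≥ 3`, at every tree coupling `0 ≤ β ≤ 17 / 100`, rate `min κ (1/10000)`
(NEW certificate: `c = 88747/1000000`, `λ = 1591/125000`, `ρ ≈ 0.9980`); HYPOTHESIS-FREE. [folklore] -/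
theorem su2_torusClusteringOnBallW_star_seventeenFiftieths_posWeight :
    ∀ κ : ℝ, 0 < κ → ∀ β : ℝ, 0 ≤ β → β ≤ 17 / 100 →
      TorusClusteringOnBallW 2 4 β κ (9 / 500) (9 / 1000) (16 * Real.exp (2 * min κ (1 / 10000))) (min κ (1 / 10000)) := by
  intro κ hκ
  have e1 : (17 / 50 : ℝ) / 2 = 17 / 100 := by norm_num
  have h := su2_torusClusteringOnBallW_star 20 (βW := 17 / 50) (κ := κ) (ε₀ := 9 / 500) (ε₁ := 9 / 1000)
    (c := 88747/1000000) (lam := 1591/125000) (t := min κ (1 / 10000))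
    (by norm_num) (by norm_num) (by norm_num) (le_min hκ.le (by norm_num)) (min_le_left _ _)
    (exp_le_taylor4 (x := 9 / 500) (by norm_num) (by norm_num)) sqrt_two_le
    ((Real.exp_le_exp.2 (min_le_right κ _)).trans (exp_le_taylor4 (x := 1 / 10000) (by norm_num) (by norm_num)))
    ((Real.exp_le_exp.2 (by linarith [min_le_right κ (1 / 10000)])).trans
      (exp_le_taylor4 (x := 1 / 5000) (by norm_num) (by norm_num)))
    (by norm_num) (by norm_num) (by norm_num) (by unfold doorPoly; norm_num)
    (by unfold gaugeR Delta; norm_num)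
  rw [e1] at h
  exact h

/-- **TIER-2 TORUS FRONTIER CELL `(β_W, ε) = (7 / 20, 0.0045)`, `SU(2)`, `d = 4`, AT EVERY WEIGHT `κ > 0`**: every member of the weighted ball
`ClusterDomain κ (9 / 1000) (9 / 2000)` clusters exponentially on every torus `(ℤ/L)⁴`, `L ≥ 3`, at every tree coupling `0 ≤ β ≤ 7 / 40`, rate `min κ (1/10000)`
(NEW certificate: `c = 17883/200000`, `λ = 1591/250000`, `ρ ≈ 0.9974`); HYPOTHESIS-FREE. [folklore] -/
theorem su2_torusClusteringOnBallW_star_sevenTwentieths_posWeight :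
    ∀ κ : ℝ, 0 < κ → ∀ β : ℝ, 0 ≤ β → β ≤ 7 / 40 →
      TorusClusteringOnBallW 2 4 β κ (9 / 1000) (9 / 2000) (16 * Real.exp (2 * min κ (1 / 10000))) (min κ (1 / 10000)) := by
  intro κ hκ
  have e1 : (7 / 20 : ℝ) / 2 = 7 / 40 := by norm_num
  have h := su2_torusClusteringOnBallW_star 20 (βW := 7 / 20) (κ := κ) (ε₀ := 9 / 1000) (ε₁ := 9 / 2000)
    (c := 17883/200000) (lam := 1591/250000) (t := min κ (1 / 10000))
    (by norm_num) (by norm_num) (by norm_num) (le_min hκ.le (by norm_num)) (min_le_left _ _)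
    (exp_le_taylor4 (x := 9 / 1000) (by norm_num) (by norm_num)) sqrt_two_le
    ((Real.exp_le_exp.2 (min_le_right κ _)).trans (exp_le_taylor4 (x := 1 / 10000) (by norm_num) (by norm_num)))
    ((Real.exp_le_exp.2 (by linarith [min_le_right κ (1 / 10000)])).trans
      (exp_le_taylor4 (x := 1 / 5000) (by norm_num) (by norm_num)))
    (by norm_num) (by norm_num) (by norm_num) (by unfold doorPoly; norm_num)
    (by unfold gaugeR Delta; norm_num)
  rw [e1] at h
  exact h

/-- **TIER-2 TORUS FRONTIER CELL `(β_W, ε) = (9 / 25, 0.0003)`, `SU(2)`, `d = 4`, AT EVERY WEIGHT `κ > 0`**: every member of the weighted ball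
`ClusterDomain κ (3 / 5000) (3 / 10000)` clusters exponentially on every torus `(ℤ/L)⁴`, `L ≥ 3`, at every tree coupling `0 ≤ β ≤ 9 / 50`, rate `min κ (1/10000)`
(NEW certificate: `c = 90131/1000000`, `λ = 17/40000`, `ρ ≈ 0.9990`); HYPOTHESIS-FREE. [folklore] -/
theorem su2_torusClusteringOnBallW_star_nineTwentyFifths_posWeight :
    ∀ κ : ℝ, 0 < κ → ∀ β : ℝ, 0 ≤ β → β ≤ 9 / 50 →
      TorusClusteringOnBallW 2 4 β κ (3 / 5000) (3 / 10000) (16 * Real.exp (2 * min κ (1 / 10000))) (min κ (1 / 10000)) := by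
  intro κ hκ
  have e1 : (9 / 25 : ℝ) / 2 = 9 / 50 := by norm_num
  have h := su2_torusClusteringOnBallW_star 20 (βW := 9 / 25) (κ := κ) (ε₀ := 3 / 5000) (ε₁ := 3 / 10000)
    (c := 90131/1000000) (lam := 17/40000) (t := min κ (1 / 10000))
    (by norm_num) (by norm_num) (by norm_num) (le_min hκ.le (by norm_num)) (min_le_left _ _)
    (exp_le_taylor4 (x := 3 / 5000) (by norm_num) (by norm_num)) sqrt_two_le
    ((Real.exp_le_exp.2 (min_le_right κ _)).trans (exp_le_taylor4 (x := 1 / 10000) (by norm_num) (by norm_num)))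
    ((Real.exp_le_exp.2 (by linarith [min_le_right κ (1 / 10000)])).trans
      (exp_le_taylor4 (x := 1 / 5000) (by norm_num) (by norm_num)))
    (by norm_num) (by norm_num) (by norm_num) (by unfold doorPoly; norm_num)
    (by unfold gaugeR Delta; norm_num)
  rw [e1] at h
  exact h

/-! ### `d = 3` frontier cells at every weight `κ > 0` — Y4's receiving currency + the torus form (rate `min κ (1/10000)`) -/

/-- **TIER-2 TORUS FRONTIER CELL `(β_W, ε) = (13 / 25, 0.011)`, `SU(2)`, `d = 3`, AT EVERY WEIGHT `κ > 0`**: Y4's receiving currency on the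
weighted ball `ClusterDomain κ (11 / 500) (11 / 1000)` up to tree coupling `13 / 50` (Wilson `β_W = 13 / 25`) at rate `min κ (1/10000)`, plus the torus form
(NEW certificate: `c = 137027/1000000`, `λ = 15557/1000000`, `ρ ≈ 0.9933`); HYPOTHESIS-FREE. [folklore] -/
theorem su2_clusterDomainClusteringW_dim3_star_thirteenTwentyFifths_posWeight :
    ∀ κ : ℝ, 0 < κ →
      YM3IR.ClusterDomainClustering (G := SUN 2)
          ⟨fundamentalRep (Fin 2), 13 / 50, fun _ _ W => W ∈ ClusterDomain κ (11 / 500) (11 / 1000)⟩ suFrobDist (min κ (1 / 10000)) ∧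
        ∀ β : ℝ, 0 ≤ β → β ≤ 13 / 50 →
          TorusClusteringOnBallW 2 3 β κ (11 / 500) (11 / 1000) (16 * Real.exp (2 * min κ (1 / 10000))) (min κ (1 / 10000)) := by
  intro κ hκ
  have e1 : (13 / 25 : ℝ) / 2 = 13 / 50 := by norm_num
  have h := su2_clusterDomainClusteringW_dim3_star 20 (βW := 13 / 25) (κ := κ) (ε₀ := 11 / 500) (ε₁ := 11 / 1000)
    (c := 137027/1000000) (lam := 15557/1000000) (t := min κ (1 / 10000))
    (by norm_num) (by norm_num) (by norm_num) (le_min hκ.le (by norm_num)) (min_le_left _ _)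
    (exp_le_taylor4 (x := 11 / 500) (by norm_num) (by norm_num)) sqrt_two_le
    ((Real.exp_le_exp.2 (min_le_right κ _)).trans (exp_le_taylor4 (x := 1 / 10000) (by norm_num) (by norm_num)))
    ((Real.exp_le_exp.2 (by linarith [min_le_right κ (1 / 10000)])).trans
      (exp_le_taylor4 (x := 1 / 5000) (by norm_num) (by norm_num)))
    (by norm_num) (by norm_num) (by norm_num) (by unfold doorPoly; norm_num)
    (by unfold gaugeR Delta; norm_num)
  rw [e1] at h
  exact h

/-- **TIER-2 TORUS FRONTIER CELL `(β_W, ε) = (27 / 50, 0.0055)`, `SU(2)`, `d = 3`, AT EVERY WEIGHT `κ > 0`**: Y4's receiving currency on the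
weighted ball `ClusterDomain κ (11 / 1000) (11 / 2000)` up to tree coupling `27 / 100` (Wilson `β_W = 27 / 50`) at rate `min κ (1/10000)`, plus the torus form
(NEW certificate: `c = 138617/1000000`, `λ = 7779/1000000`, `ρ ≈ 0.9953`); HYPOTHESIS-FREE. [folklore] -/
theorem su2_clusterDomainClusteringW_dim3_star_twentySevenFiftieths_posWeight :
    ∀ κ : ℝ, 0 < κ →
      YM3IR.ClusterDomainClustering (G := SUN 2)
          ⟨fundamentalRep (Fin 2), 27 / 100, fun _ _ W => W ∈ ClusterDomain κ (11 / 1000) (11 / 2000)⟩ suFrobDist (min κ (1 / 10000)) ∧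
        ∀ β : ℝ, 0 ≤ β → β ≤ 27 / 100 →
          TorusClusteringOnBallW 2 3 β κ (11 / 1000) (11 / 2000) (16 * Real.exp (2 * min κ (1 / 10000))) (min κ (1 / 10000)) := by
  intro κ hκ
  have e1 : (27 / 50 : ℝ) / 2 = 27 / 100 := by norm_num
  have h := su2_clusterDomainClusteringW_dim3_star 20 (βW := 27 / 50) (κ := κ) (ε₀ := 11 / 1000) (ε₁ := 11 / 2000)
    (c := 138617/1000000) (lam := 7779/1000000) (t := min κ (1 / 10000))
    (by norm_num) (by norm_num) (by norm_num) (le_min hκ.le (by norm_num)) (min_le_left _ _)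
    (exp_le_taylor4 (x := 11 / 1000) (by norm_num) (by norm_num)) sqrt_two_le
    ((Real.exp_le_exp.2 (min_le_right κ _)).trans (exp_le_taylor4 (x := 1 / 10000) (by norm_num) (by norm_num)))
    ((Real.exp_le_exp.2 (by linarith [min_le_right κ (1 / 10000)])).trans
      (exp_le_taylor4 (x := 1 / 5000) (by norm_num) (by norm_num)))
    (by norm_num) (by norm_num) (by norm_num) (by unfold doorPoly; norm_num)
    (by unfold gaugeR Delta; norm_num)
  rw [e1] at h
  exact h

/-- **TIER-2 TORUS FRONTIER CELL `(β_W, ε) = (11 / 20, 0.003)`, `SU(2)`, `d = 3`, AT EVERY WEIGHT `κ > 0`**: Y4's receiving currency on the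
weighted ball `ClusterDomain κ (3 / 500) (3 / 1000)` up to tree coupling `11 / 40` (Wilson `β_W = 11 / 20`) at rate `min κ (1/10000)`, plus the torus form
(NEW certificate: `c = 69751/500000`, `λ = 4243/1000000`, `ρ ≈ 0.9984`); HYPOTHESIS-FREE. [folklore] -/
theorem su2_clusterDomainClusteringW_dim3_star_elevenTwentieths_posWeight :
    ∀ κ : ℝ, 0 < κ →
      YM3IR.ClusterDomainClustering (G := SUN 2)
          ⟨fundamentalRep (Fin 2), 11 / 40, fun _ _ W => W ∈ ClusterDomain κ (3 / 500) (3 / 1000)⟩ suFrobDist (min κ (1 / 10000)) ∧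
        ∀ β : ℝ, 0 ≤ β → β ≤ 11 / 40 →
          TorusClusteringOnBallW 2 3 β κ (3 / 500) (3 / 1000) (16 * Real.exp (2 * min κ (1 / 10000))) (min κ (1 / 10000)) := by
  intro κ hκ
  have e1 : (11 / 20 : ℝ) / 2 = 11 / 40 := by norm_num
  have h := su2_clusterDomainClusteringW_dim3_star 20 (βW := 11 / 20) (κ := κ) (ε₀ := 3 / 500) (ε₁ := 3 / 1000)
    (c := 69751/500000) (lam := 4243/1000000) (t := min κ (1 / 10000))
    (by norm_num) (by norm_num) (by norm_num) (le_min hκ.le (by norm_num)) (min_le_left _ _)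
    (exp_le_taylor4 (x := 3 / 500) (by norm_num) (by norm_num)) sqrt_two_le
    ((Real.exp_le_exp.2 (min_le_right κ _)).trans (exp_le_taylor4 (x := 1 / 10000) (by norm_num) (by norm_num)))
    ((Real.exp_le_exp.2 (by linarith [min_le_right κ (1 / 10000)])).trans
      (exp_le_taylor4 (x := 1 / 5000) (by norm_num) (by norm_num)))
    (by norm_num) (by norm_num) (by norm_num) (by unfold doorPoly; norm_num)
    (by unfold gaugeR Delta; norm_num)
  rw [e1] at h
  exact h

/-- **TIER-2 TORUS FRONTIER CELL `(β_W, ε) = (14 / 25, 0.0003)`, `SU(2)`, `d = 3`, AT EVERY WEIGHT `κ > 0`**: Y4's receiving currency on the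
weighted ball `ClusterDomain κ (3 / 5000) (3 / 10000)` up to tree coupling `7 / 25` (Wilson `β_W = 14 / 25`) at rate `min κ (1/10000)`, plus the torus form
(NEW certificate: `c = 140203/1000000`, `λ = 17/40000`, `ρ ≈ 0.9987`); HYPOTHESIS-FREE. [folklore] -/
theorem su2_clusterDomainClusteringW_dim3_star_fourteenTwentyFifths_posWeight :
    ∀ κ : ℝ, 0 < κ →
      YM3IR.ClusterDomainClustering (G := SUN 2)
          ⟨fundamentalRep (Fin 2), 7 / 25, fun _ _ W => W ∈ ClusterDomain κ (3 / 5000) (3 / 10000)⟩ suFrobDist (min κ (1 / 10000)) ∧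
        ∀ β : ℝ, 0 ≤ β → β ≤ 7 / 25 →
          TorusClusteringOnBallW 2 3 β κ (3 / 5000) (3 / 10000) (16 * Real.exp (2 * min κ (1 / 10000))) (min κ (1 / 10000)) := by
  intro κ hκ
  have e1 : (14 / 25 : ℝ) / 2 = 7 / 25 := by norm_num
  have h := su2_clusterDomainClusteringW_dim3_star 20 (βW := 14 / 25) (κ := κ) (ε₀ := 3 / 5000) (ε₁ := 3 / 10000)
    (c := 140203/1000000) (lam := 17/40000) (t := min κ (1 / 10000))
    (by norm_num) (by norm_num) (by norm_num) (le_min hκ.le (by norm_num)) (min_le_left _ _)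
    (exp_le_taylor4 (x := 3 / 5000) (by norm_num) (by norm_num)) sqrt_two_le
    ((Real.exp_le_exp.2 (min_le_right κ _)).trans (exp_le_taylor4 (x := 1 / 10000) (by norm_num) (by norm_num)))
    ((Real.exp_le_exp.2 (by linarith [min_le_right κ (1 / 10000)])).trans
      (exp_le_taylor4 (x := 1 / 5000) (by norm_num) (by norm_num)))
    (by norm_num) (by norm_num) (by norm_num) (by unfold doorPoly; norm_num)
    (by unfold gaugeR Delta; norm_num)
  rw [e1] at h
  exact h

/-! ### Packaged ceilings -/

/-- **PACKAGED, `d = 4`, the endpoint cell**: for EVERY `κ > 0` there are a constant and a positive rate `m ≤ κ` with torus-uniform exponential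
clustering of every member of `ClusterDomain κ (3/5000) (3/10000)` at every tree coupling `0 ≤ β ≤ 9/50` (Wilson `β_W ≤ 9/25`). [folklore] -/
theorem su2_torusClusteringOnBallW_star_nineTwentyFifths_everyWeight {κ : ℝ} (hκ : 0 < κ) :
    ∃ A m : ℝ, 0 < m ∧ m ≤ κ ∧ ∀ β : ℝ, 0 ≤ β → β ≤ 9 / 50 → TorusClusteringOnBallW 2 4 β κ (3 / 5000) (3 / 10000) A m :=
  ⟨_, _, lt_min hκ (by norm_num), min_le_left _ _, su2_torusClusteringOnBallW_star_nineTwentyFifths_posWeight κ hκ⟩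

/-- **PACKAGED, `d = 3`, the Y4 CEILING at every weight**: for EVERY `κ > 0` there is a positive rate `m ≤ κ` with
`YM3IR.ClusterDomainClustering ⟨ρ₂, 7/25, ClusterDomain κ (3/5000) (3/10000)⟩ suFrobDist m` (`SU(2)`, `d = 3`, Wilson `β_W ≤ 14/25`). [folklore] -/
theorem su2_clusterDomainClusteringW_dim3_star_fourteenTwentyFifths_everyWeight {κ : ℝ} (hκ : 0 < κ) :
    ∃ m : ℝ, 0 < m ∧ m ≤ κ ∧ YM3IR.ClusterDomainClustering (G := SUN 2)
      ⟨fundamentalRep (Fin 2), 7 / 25, fun _ _ W => W ∈ ClusterDomain κ (3 / 5000) (3 / 10000)⟩ suFrobDist m :=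
  ⟨_, lt_min hκ (by norm_num), min_le_left _ _, (su2_clusterDomainClusteringW_dim3_star_fourteenTwentyFifths_posWeight κ hκ).1⟩

end Summit.Ventures.YMGap.RobustBall

end
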